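import Literature.Topology.FourManifolds.RearrangementSlabProofs
import Literature.Topology.FourManifolds.HandleSpheresRearrangementProofs
import HarnessLib

/-!
# What the discharge of Thms. 4.1/4.2 on a slab unlocks: Thms. 4.1/4.2 for a whole cobordism,
# Thm. 4.8 from Thm. 4.4 on a slab, and the leaves under Thm. 8.1 Index 1

Topic `Literature/Topology/FourManifolds` (fact seat
`provefact-Literature.Topology.FourManifolds.Cobordism.Milnor1965_trade_index_one`).  Bookkeeping
after `Literature.Topology.FourManifolds.Cobordism.Milnor1965_rearrangement_slab_holds`
(`RearrangementSlabProofs.lean`: Milnor's Thms. 4.1/4.2 on a sub-triad `f⁻¹[a₀, a₁]`,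
`0 < a₀ < a₁ < 1`, are a theorem of the tree).  Everything here is **proved**; no definitions,
no named facts:

* `Cobordism.Milnor1965_preliminaryRearrangement_holds` — **discharge** of the named fact
  `Literature.Topology.FourManifolds.Cobordism.Milnor1965_preliminaryRearrangement`
  (`HandleSpheres.lean`, Thms. 4.1/4.2 for a whole cobordism), by
  `Milnor1965_preliminaryRearrangement_of_slab` (`HandleSpheresRearrangementProofs.lean`);
* `Cobordism.Milnor1965_finalRearrangement_of_disjoint_spheres_slab` — Thm. 4.8
  (`Literature.Topology.FourManifolds.Cobordism.Milnor1965_finalRearrangement`) now follows from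
  Thm. 4.4 on a slab alone
  (`Literature.Topology.FourManifolds.Cobordism.Milnor1965_exists_isGradientLike_disjoint_spheres_slab`),
  by `Milnor1965_finalRearrangement_of_slab` (`MorseRearrangementProofs.lean`);
* `Cobordism.Milnor1965_trade_index_one_of_three_leaves` — Thm. 8.1 Index 1
  (`Literature.Topology.FourManifolds.Cobordism.Milnor1965_trade_index_one`,
  `HCobordismIndexZeroOne.lean`) now rests on three named facts: the insertion of the auxiliary
  pair (`Milnor1965_exists_auxiliaryPair`, PDF pp. 55–56), the First Cancellation Theorem 5.4
  on a slab (`Milnor1965_firstCancellation_slab` — itself reduced in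
  `HCobordismFirstCancellation.lean` to Assertion 6 and Assertions 1–3, Assertions 4–5 being
  `Milnor1965_cancellation_functionOfCrossingField_holds` of `HCobordismCancellationFunction.lean`)
  and Thm. 4.4 on a slab; by `Milnor1965_trade_index_one_of_steps` (`HCobordismTradeStep.lean`).

## References

* J. Milnor, *Lectures on the h-cobordism theorem*, notes by L. Siebenmann and J. Sondow,
  Princeton Mathematical Notes (1965): Thms. 4.1, 4.2 (PDF pp. 22–23), 4.4 (PDF pp. 23–25),
  4.8 (PDF p. 25), Thm. 8.1 and its proof (PDF pp. 54–57).  Held: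
  `lit read book:milnornd-lectures-h-cobordism-theorem`. [MilnorHCobordism1965]
-/

open Set Function Filter
open scoped Manifold Topology ContDiff

noncomputable section

namespace Literature.Topology.FourManifolds

universe u

namespace Cobordism

/-- **Milnor 1965, Thms. 4.1–4.2 for a whole cobordism — discharged**: the named fact
`Literature.Topology.FourManifolds.Cobordism.Milnor1965_preliminaryRearrangement` (`HandleSpheres.lean`)
holds, by `Milnor1965_preliminaryRearrangement_of_slab` (`HandleSpheresRearrangementProofs.lean`)
and `Milnor1965_rearrangement_slab_holds` (`RearrangementSlabProofs.lean`). [cite: MilnorHCobordism1965, Thms. 4.1, 4.2 (PDF pp. 22–23)] -/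
theorem Milnor1965_preliminaryRearrangement_holds : Milnor1965_preliminaryRearrangement.{u} :=
  Milnor1965_preliminaryRearrangement_of_slab Milnor1965_rearrangement_slab_holds

/-- **Milnor 1965, Thm. 4.8 from Thm. 4.4 on a slab alone**: the named fact
`Literature.Topology.FourManifolds.Cobordism.Milnor1965_finalRearrangement` follows from
`Literature.Topology.FourManifolds.Cobordism.Milnor1965_exists_isGradientLike_disjoint_spheres_slab`
(`Milnor1965_finalRearrangement_of_slab`, `MorseRearrangementProofs.lean`, with
`Milnor1965_rearrangement_slab_holds`). [cite: MilnorHCobordism1965, Thm. 4.8 (PDF p. 25)] -/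
theorem Milnor1965_finalRearrangement_of_disjoint_spheres_slab
    (h44 : Milnor1965_exists_isGradientLike_disjoint_spheres_slab.{u}) :
    Milnor1965_finalRearrangement.{u} :=
  Milnor1965_finalRearrangement_of_slab h44 Milnor1965_rearrangement_slab_holds

/-- **What `Milnor1965_trade_index_one` (Thm. 8.1 Index 1) now rests on**: the insertion of the
auxiliary pair (`Milnor1965_exists_auxiliaryPair`), the First Cancellation Theorem 5.4 on a slab
(`Milnor1965_firstCancellation_slab`) and Thm. 4.4 on a slab
(`Milnor1965_exists_isGradientLike_disjoint_spheres_slab`) — by `Milnor1965_trade_index_one_of_steps`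
(`HCobordismTradeStep.lean`) with `Milnor1965_rearrangement_slab_holds` and
`Milnor1965_finalRearrangement_of_disjoint_spheres_slab`.
[cite: MilnorHCobordism1965, Thm. 8.1 Index 1 and its proof (PDF pp. 54–57)] -/
theorem Milnor1965_trade_index_one_of_three_leaves
    (hA : Milnor1965_exists_auxiliaryPair.{u})
    (h54 : Milnor1965_firstCancellation_slab.{u})
    (h44 : Milnor1965_exists_isGradientLike_disjoint_spheres_slab.{u}) :
    Milnor1965_trade_index_one.{u} :=
  Milnor1965_trade_index_one_of_steps hA Milnor1965_rearrangement_slab_holds h54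
    (Milnor1965_finalRearrangement_of_disjoint_spheres_slab h44)

end Cobordism

end Literature.Topology.FourManifolds
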